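import Literature.Geometry.Kaehler.ComplexTorusHilbertModularCuspStabilizerLogLatticeAveraging
import HarnessLib

/-!
# Constant representatives: every class of `H^{k+1}((ℍⁿ, Γ_∞))` is `(Θ⁻¹)^*` of a constant covector
# (Freitag, *Hilbert Modular Forms*, Ch. III §2, proof of Prop. 2.1, pp. 144–145)

Geometry/Kaehler ∕ NumberTheory/Automorphic support file, sequel of `…CuspStabilizerLogLatticeAveraging` (every class is
`[(Θ⁻¹)^* A]` with `A = logAvg` invariant under `x`- and `i·H₀`-translations), `…CuspStabilizerSliceRetraction` (`[r^♯ω] = [ω]`,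
`r^♯ = (Θ⁻¹)^* sliceP^* Θ^*`) and `…CuspStabilizerTranslationAverageInvariance` (`[η] = [xAvg η]`). Everything proved; one
definition with body (`constSliceForm`), no named fact.

Freitag (p. 145) concludes with Hodge theory on the compact torus `D/Γ_∞`: harmonic forms have constant coefficients. On
the de Rham carrier the same conclusion is reached by the three averaging ∕ retraction steps already in the tree:

* §1 `Θ^*((Θ⁻¹)^*A) = A` (`logForm_expForm`); the lattice directions of the log-lattice chart exhaust `i·H₀`
  (`exists_dirVec_logLatticeChart_eq_imagVec`), so the lattice average is CONSTANT on the slice `ℝⁿ ⊕ i·H₀ = sliceP(ℂⁿ)`: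
  `A(sliceP w) = A(0)` (`logAvg_sliceP`);
* §2 hence `r^♯((Θ⁻¹)^*A) = (Θ⁻¹)^*(w ↦ A(0) ∘ sliceP)` (`slicePull_expForm_logAvg`): with
  `constSliceForm C := (Θ⁻¹)^*(w ↦ C ∘ sliceP)`, **`[ω] = [constSliceForm (A 0)]`** for every `x`-independent
  `ω ∈ closedForms Γ_∞ (k+1)` (`mk_eq_mk_constSliceForm`), where the covector `A 0` is invariant under the linear parts of
  `Γ_∞`: `A(0) ∘ logActL ε = A(0)` (`logAvg_zero_comp_logActL`);
* §3 with the `x`-average of `…TranslationAverageInvariance`: **every class of `H^{k+1}((ℍⁿ, Γ_∞))` is `[constSliceForm C]`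
  for a constant covector `C` with `C ∘ logActL ε = C` for all multipliers** (`exists_covector_mk_eq_mk_constSliceForm`).

## References

* [Freitag1990] E. Freitag, *Hilbert Modular Forms*, Springer (1990): Ch. III §2, proof of Prop. 2.1, pp. 144–145.
* [BottTu1982Forms] R. Bott, L. Tu, *Differential Forms in Algebraic Topology*, GTM 82 (1982), §I.4.
-/

noncomputable section

/- Instance search through the form spaces `Point F [⋀^Fin p]→L[ℝ] ℂ` nests pending instance problems three deep
(see `…HilbertModularInvariantForms`). -/
set_option maxSynthPendingDepth 3

open scoped Matrix MatrixGroups Classical Topology ContDiff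

open Set Function Filter Complex ContinuousAlternatingMap

namespace Literature.NumberTheory.Automorphic.HilbertModular

open _root_.NumberField _root_.NumberField.InfinitePlace _root_.NumberField.Units _root_.NumberField.Units.dirichletUnitTheorem
open Module
open Literature.Geometry.Kaehler.ComplexTorus.HilbertModularFamily
open Literature.NumberTheory.Automorphic (HilbertModular.deRhamCohomology.mk HilbertModular.deRhamCohomology.mk_eq_mk_iff)
open Literature.Analysis.FunctionSpaces (Torus.dirVec Torus.dirVec_apply)

variable {F : Type*} [Field F] [NumberField F] [IsTotallyReal F]

/-! ## §1 The lattice average is constant on the slice -/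

section SliceConstant

variable {Γ : Subgroup SL(2, F)} {k : ℕ}

omit [IsTotallyReal F] in
/-- `DΘ⁻¹(Θ w) ∘ DΘ(w) = id`. [cite: Freitag1990, Ch. I §2 Lemma 2.10₁, p. 31] -/
theorem fderiv_logIm_comp_fderiv_expIm (w : Point F) :
    (fderiv ℝ logIm (expIm w)).comp (fderiv ℝ (expIm : Point F → Point F) w) = ContinuousLinearMap.id ℝ (Point F) := by
  have h : (logIm ∘ expIm : Point F → Point F) = id := funext fun w => logIm_expIm w
  rw [← fderiv_comp w (differentiableAt_logIm (expIm_mem_halfSpace w)) (differentiable_expIm w), h, fderiv_id]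

omit [IsTotallyReal F] in
/-- **`Θ^*((Θ⁻¹)^*A) = A`.** [cite: Freitag1990, Ch. I §2 Lemma 2.10₁, p. 31; BottTu1982Forms, §I.4] -/
theorem logForm_expForm (A : Form F k) : logForm (expForm A) = A := by
  funext w
  rw [logForm_apply_eq, expForm_of_mem _ (expIm_mem_halfSpace w), logIm_expIm]
  ext v
  simp only [ContinuousAlternatingMap.compContinuousLinearMap_apply, Function.comp_def]
  congr 1
  funext i
  exact congrArg (fun T : Point F →L[ℝ] Point F => T (v i)) (fderiv_logIm_comp_fderiv_expIm w)

/-- A sum over the real embeddings splits as the `σ₀`-term (`σ₀` the embedding of `w₀`) plus the sum over the places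
`w ≠ w₀`. [folklore] -/
private theorem sum_emb_eq (g : (F →+* ℝ) → ℝ) :
    ∑ σ, g σ = g (realEmb F ⟨w₀, IsTotallyReal.isReal _⟩) + ∑ w : {w : InfinitePlace F // w ≠ w₀}, g (realEmb F (placeOf w)) := by
  let e : RealPlace F ≃ InfinitePlace F := Equiv.subtypeUnivEquiv fun w : InfinitePlace F => IsTotallyReal.isReal w
  rw [← Fintype.sum_equiv (realPlaceEquiv F) (fun v => g (realEmb F v)) g fun v => rfl,
    ← Fintype.sum_equiv e.symm (fun w => g (realEmb F (e.symm w))) (fun v => g (realEmb F v)) fun _ => rfl,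
    ← Finset.add_sum_erase _ _ (Finset.mem_univ w₀),
    Finset.sum_subtype (Finset.univ.erase w₀) (p := fun w => w ≠ w₀) (fun w => by simp)
      (f := fun w => g (realEmb F (e.symm w)))]
  rfl

/-- Every real embedding is `σ₀` or the embedding of a place `w ≠ w₀`. [folklore] -/
private theorem emb_eq_or (σ : F →+* ℝ) :
    σ = realEmb F ⟨w₀, IsTotallyReal.isReal _⟩ ∨ ∃ w : {w : InfinitePlace F // w ≠ w₀}, σ = realEmb F (placeOf w) := by
  by_cases h : ((realPlaceEquiv F).symm σ).1 = w₀
  · left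
    rw [← realEmb_realPlaceEquiv_symm (F := F) σ]
    exact congrArg (realEmb F) (Subtype.ext h)
  · right
    refine ⟨⟨((realPlaceEquiv F).symm σ).1, h⟩, ?_⟩
    conv_lhs => rw [← realEmb_realPlaceEquiv_symm (F := F) σ]
    rfl

/-- Two trace-zero vectors agreeing at the embeddings of the places `≠ w₀` are equal. [folklore] -/
private theorem eq_of_sum_eq_zero_of_forall_placeOf {g g' : (F →+* ℝ) → ℝ} (hg : ∑ σ, g σ = 0) (hg' : ∑ σ, g' σ = 0)
    (h : ∀ w : {w : InfinitePlace F // w ≠ w₀}, g (realEmb F (placeOf w)) = g' (realEmb F (placeOf w))) : g = g' := by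
  have h0 : g (realEmb F ⟨w₀, IsTotallyReal.isReal _⟩) = g' (realEmb F ⟨w₀, IsTotallyReal.isReal _⟩) := by
    rw [sum_emb_eq] at hg hg'
    simp only [h] at hg
    linarith
  funext σ
  rcases emb_eq_or σ with hσ | ⟨w, hσ⟩
  · rw [hσ, h0]
  · rw [hσ, h w]

/-- **The trace-zero extension is onto the trace-zero hyperplane `H₀`.** [cite: Freitag1990, Ch. I §2 2.4, p. 28] -/
theorem exists_traceZeroExt_eq {h : (F →+* ℝ) → ℝ} (hh : ∑ σ, h σ = 0) : ∃ ℓ : logSpace F, traceZeroExt F ℓ = h :=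
  ⟨fun w => h (realEmb F (placeOf w)), eq_of_sum_eq_zero_of_forall_placeOf (sum_traceZeroExt _) hh fun w =>
    traceZeroExt_apply_realEmb_placeOf _ w⟩

/-- **The lattice directions exhaust `i·H₀`**: every trace-zero imaginary vector is a direction of the log-lattice chart.
[cite: Freitag1990, Ch. I §2 2.4–2.5, p. 28] -/
theorem exists_dirVec_logLatticeChart_eq_imagVec (hΓ : HasCuspInfty Γ) {h : (F →+* ℝ) → ℝ} (hh : ∑ σ, h σ = 0) :
    ∃ s : EuclideanSpace ℝ (LogLatticeIdx F), Torus.dirVec (logLatticeChart hΓ) s = imagVec h := by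
  obtain ⟨ℓ, hℓ⟩ := exists_traceZeroExt_eq hh
  refine ⟨WithLp.toLp 2 ((logLatticeBasisH0 hΓ).equivFun ℓ), ?_⟩
  rw [dirVec_logLatticeChart, ← hℓ]
  congr 1
  congr 1
  exact (logLatticeBasisH0 hΓ).sum_equivFun ℓ

omit [IsTotallyReal F] in
/-- A point of the slice `sliceP(ℂⁿ)` is a real vector plus a trace-zero imaginary vector. [cite: Freitag1990, Ch. III §2, p. 144] -/
theorem sliceP_eq_realToPoint_add_imagVec (w : Point F) :
    sliceP w = realToPoint F (fun σ => (w σ).re) + imagVec fun σ => (sliceP w σ).im := by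
  funext σ
  apply Complex.ext
  · rw [Pi.add_apply, Complex.add_re, realToPoint_apply, imagVec_apply_re, Complex.ofReal_re, add_zero, sliceP_apply_re]
  · rw [Pi.add_apply, Complex.add_im, realToPoint_apply, imagVec_apply_im, Complex.ofReal_im, zero_add]

/-- **The lattice average is constant on the slice: `A(sliceP w) = A(0)`.** [cite: Freitag1990, Ch. III §2, proof of
Prop. 2.1, p. 145 («harmonic forms … constant coefficients»)] -/
theorem logAvg_sliceP (hΓ : HasCuspInfty Γ) {α : Form F k} (hα : α ∈ invariantForms (stabInfty Γ) k)
    (hαx : ∀ z x, α (z + realToPoint F x) = α z) (w : Point F) : logAvg hΓ α (sliceP w) = logAvg hΓ α 0 := by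
  obtain ⟨s, hs⟩ := exists_dirVec_logLatticeChart_eq_imagVec hΓ (sum_im_sliceP w)
  rw [sliceP_eq_realToPoint_add_imagVec, ← hs, logAvg_add_dirVec hα hαx, ← zero_add (realToPoint F _),
    logAvg_add_realToPoint hα hαx]

end SliceConstant

/-! ## §2 Constant representatives -/

section Constant

variable {Γ : Subgroup SL(2, F)} {k : ℕ}

/-- **The form of a constant covector on the slice**: `constSliceForm C = (Θ⁻¹)^*(w ↦ C ∘ sliceP)` on `ℍⁿ` (zero off it).
[cite: Freitag1990, Ch. III §2, proof of Prop. 2.1, p. 145] -/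
def constSliceForm (C : Point F [⋀^Fin k]→L[ℝ] ℂ) : Form F k :=
  expForm fun _ => C.compContinuousLinearMap (sliceP : Point F →L[ℝ] Point F)

omit [IsTotallyReal F] in
/-- `constSliceForm` is additive in the covector. [cite: Freitag1990, Ch. III §2, p. 145] -/
theorem constSliceForm_add (C C' : Point F [⋀^Fin k]→L[ℝ] ℂ) :
    constSliceForm (C + C') = constSliceForm C + constSliceForm C' := by
  funext z
  by_cases hz : z ∈ halfSpace F
  · rw [constSliceForm, constSliceForm, constSliceForm, Pi.add_apply, expForm_of_mem _ hz, expForm_of_mem _ hz,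
      expForm_of_mem _ hz]
    ext v; simp
  · rw [constSliceForm, constSliceForm, constSliceForm, Pi.add_apply, expForm_of_not_mem _ hz, expForm_of_not_mem _ hz,
      expForm_of_not_mem _ hz, add_zero]

omit [IsTotallyReal F] in
/-- `constSliceForm` is homogeneous in the covector. [cite: Freitag1990, Ch. III §2, p. 145] -/
theorem constSliceForm_smul (a : ℂ) (C : Point F [⋀^Fin k]→L[ℝ] ℂ) : constSliceForm (a • C) = a • constSliceForm C := by
  funext z
  by_cases hz : z ∈ halfSpace F
  · rw [constSliceForm, constSliceForm, Pi.smul_apply, expForm_of_mem _ hz, expForm_of_mem _ hz]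
    ext v; simp
  · rw [constSliceForm, constSliceForm, Pi.smul_apply, expForm_of_not_mem _ hz, expForm_of_not_mem _ hz, smul_zero]

/-- **`r^♯((Θ⁻¹)^*A) = constSliceForm (A 0)`** for the lattice average `A` of an `x`-independent invariant form.
[cite: Freitag1990, Ch. III §2, proof of Prop. 2.1, p. 145] -/
theorem slicePull_expForm_logAvg (hΓ : HasCuspInfty Γ) {α : Form F k} (hα : α ∈ invariantForms (stabInfty Γ) k)
    (hαx : ∀ z x, α (z + realToPoint F x) = α z) :
    slicePull (expForm (logAvg hΓ α)) = constSliceForm (logAvg hΓ α 0) := by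
  unfold slicePull constSliceForm
  rw [logForm_expForm]
  refine congrArg expForm (funext fun w => ?_)
  rw [pullForm_apply_eq, (sliceP : Point F →L[ℝ] Point F).fderiv, logAvg_sliceP hΓ hα hαx]

/-- `constSliceForm (A 0)` is closed invariant. [cite: Freitag1990, Ch. III §2, proof of Prop. 2.1, p. 145] -/
theorem constSliceForm_logAvg_mem_closedForms (hΓ : HasCuspInfty Γ) {α : Form F (k + 1)}
    (hα : α ∈ closedForms (stabInfty Γ) (k + 1)) (hαx : ∀ z x, α (z + realToPoint F x) = α z) :
    constSliceForm (logAvg hΓ α 0) ∈ closedForms (stabInfty Γ) (k + 1) := by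
  rw [← slicePull_expForm_logAvg hΓ (closedForms_le_invariantForms _ _ hα) hαx]
  exact slicePull_mem_closedForms hΓ (expForm_logAvg_mem_closedForms hα hαx)

/-- **`[ω] = [constSliceForm (A 0)]` in `H^{k+1}((ℍⁿ, Γ_∞))`** for every `x`-independent `ω ∈ closedForms Γ_∞ (k+1)` of a
group with cusp `∞`: the class is represented by the transport of a CONSTANT covector.
[cite: Freitag1990, Ch. III §2, proof of Prop. 2.1, p. 145] -/
theorem mk_eq_mk_constSliceForm (hΓ : HasCuspInfty Γ) {α : Form F (k + 1)} (hα : α ∈ closedForms (stabInfty Γ) (k + 1))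
    (hαx : ∀ z x, α (z + realToPoint F x) = α z) :
    HilbertModular.deRhamCohomology.mk (stabInfty Γ) (k + 1) ⟨α, hα⟩ =
      HilbertModular.deRhamCohomology.mk (stabInfty Γ) (k + 1)
        ⟨constSliceForm (logAvg hΓ α 0), constSliceForm_logAvg_mem_closedForms hΓ hα hαx⟩ := by
  rw [mk_eq_mk_expForm_logAvg hα hαx (hΓ := hΓ),
    ← mk_slicePull_eq hΓ ⟨expForm (logAvg hΓ α), expForm_logAvg_mem_closedForms hα hαx⟩]
  congr 1
  exact Subtype.ext (slicePull_expForm_logAvg hΓ (closedForms_le_invariantForms _ _ hα) hαx)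

omit [NumberField F] [IsTotallyReal F] in
/-- `logAct ε m (0) = (σ(ε)σ(m))_σ + i log ε²`: a real vector plus the imaginary log-vector of the multiplier.
[cite: Freitag1990, Ch. I §2 Lemma 2.10₁, p. 31] -/
theorem logAct_zero_eq (e : Fˣ) (m : F) :
    logAct e m (0 : Point F) = realToPoint F (fun σ => σ (e : F) * σ m) + imagVec (logEmb ((e ^ 2 : Fˣ) : F)) := by
  funext σ
  simp only [logAct, Pi.zero_apply, Complex.zero_re, Complex.zero_im, mul_zero, zero_add, Pi.add_apply]
  apply Complex.ext
  · simp [realToPoint_apply, imagVec_apply_re]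
  · simp [realToPoint_apply, imagVec_apply_im, logEmb_apply, Units.val_pow_eq_pow_val, map_pow]

/-- **The representing covector is invariant under the linear parts of `Γ_∞`: `A(0) ∘ logActL ε = A(0)`.**
[cite: Freitag1990, Ch. III §2, proof of Prop. 2.1, p. 145] -/
theorem logAvg_zero_comp_logActL (hΓ : HasCuspInfty Γ) {α : Form F k} (hα : α ∈ invariantForms (stabInfty Γ) k)
    (hαx : ∀ z x, α (z + realToPoint F x) = α z) {e : Fˣ} {m : F} (hγ : upperTri e m ∈ stabInfty Γ) :
    (logAvg hΓ α 0).compContinuousLinearMap (logActL e) = logAvg hΓ α 0 := by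
  have h := congrFun (pullForm_logAct_logAvg hα hαx hγ (hΓ := hΓ)) 0
  rw [pullForm_apply_eq, fderiv_logAct, logAct_zero_eq] at h
  -- the translation vector: real part plus a lattice direction
  have hsum : ∑ σ, logEmb ((e ^ 2 : Fˣ) : F) σ = 0 := by
    have hε : e ^ 2 ∈ multiplierGroup Γ := sq_mem_multiplierGroup_of_mem_stabInfty hγ
    have hpos : ∀ σ : F →+* ℝ, 0 < σ ((e ^ 2 : Fˣ) : F) := emb_sq_pos e
    have hp : ∏ σ : F →+* ℝ, σ ((e ^ 2 : Fˣ) : F) = 1 := by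
      rw [← Fintype.prod_equiv (realPlaceEquiv F) (fun v => realEmb F v ((e ^ 2 : Fˣ) : F))
        (fun σ : F →+* ℝ => σ ((e ^ 2 : Fˣ) : F)) fun v => rfl]
      exact hΓ.prod_realEmb_eq_one hε
    have hl := Real.log_prod (s := Finset.univ) (f := fun σ : F →+* ℝ => σ ((e ^ 2 : Fˣ) : F)) fun σ _ => (hpos σ).ne'
    rw [hp, Real.log_one] at hl
    simpa [logEmb_apply] using hl.symm
  obtain ⟨s, hs⟩ := exists_dirVec_logLatticeChart_eq_imagVec hΓ hsum
  rw [← hs, logAvg_add_dirVec hα hαx, ← zero_add (realToPoint F _), logAvg_add_realToPoint hα hαx] at h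
  exact h

end Constant

/-! ## §3 Every class has a constant representative -/

section Every

variable {Γ : Subgroup SL(2, F)} {k : ℕ}

/-- **Every class of `H^{k+1}((ℍⁿ, Γ_∞))` is represented by the transport of a constant covector invariant under the linear
parts of `Γ_∞`** (for a group with cusp `∞`): `x`-average (`mk_eq_mk_xAvg`), sector decomposition and character kill,
lattice average in `log y`, and retraction onto the slice. [cite: Freitag1990, Ch. III §2, Prop. 2.1 and its proof, pp. 143–145] -/
theorem exists_covector_mk_eq_mk_constSliceForm (hΓ : HasCuspInfty Γ) (c : deRhamCohomology (stabInfty Γ) (k + 1)) :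
    ∃ C : Point F [⋀^Fin (k + 1)]→L[ℝ] ℂ,
      (∀ (e : Fˣ) (m : F), upperTri e m ∈ stabInfty Γ → C.compContinuousLinearMap (logActL e) = C) ∧
      ∃ hC : constSliceForm C ∈ closedForms (stabInfty Γ) (k + 1),
        c = HilbertModular.deRhamCohomology.mk (stabInfty Γ) (k + 1) ⟨constSliceForm C, hC⟩ := by
  obtain ⟨⟨η, hη⟩, rfl⟩ := HilbertModular.deRhamCohomology.mk_surjective (stabInfty Γ) (k + 1) c
  have hηi : η ∈ invariantForms (stabInfty Γ) (k + 1) := closedForms_le_invariantForms _ _ hη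
  set α : Form F (k + 1) := hΓ.xAvg η with hα_def
  have hα : α ∈ closedForms (stabInfty Γ) (k + 1) := hΓ.xAvg_mem_closedForms hη
  have hαx : ∀ z x, α (z + realToPoint F x) = α z := fun z x =>
    hΓ.xAvg_add_realToPoint (isTranslationPeriodic_of_mem_invariantForms hηi) z x
  refine ⟨logAvg hΓ α 0, fun e m hγ => logAvg_zero_comp_logActL hΓ (closedForms_le_invariantForms _ _ hα) hαx hγ,
    constSliceForm_logAvg_mem_closedForms hΓ hα hαx, ?_⟩
  rw [hΓ.mk_eq_mk_xAvg hη]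
  exact mk_eq_mk_constSliceForm hΓ hα hαx

end Every

end Literature.NumberTheory.Automorphic.HilbertModular
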